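import Literature.NumberTheory.Sieve.MoebiusShiftedPrimesMeanSquare
import Literature.NumberTheory.Sieve.MoebiusShiftedPrimesDecompositionWith
import HarnessLib

/-!
# Möbius on shifted primes — the circle-method layers of Lichtman 2020 along the corrected sets `S_c`

Topic `Literature/NumberTheory/Sieve`, part of the decomposition of the named facts
`Literature.NumberTheory.Sieve.lichtman2020_moebius_shifted_primes_avg` and
`Literature.NumberTheory.Sieve.lichtman2020_moebius_shifted_primes_avg_power` (J. D. Lichtman,
*Averages of the Möbius function on shifted primes*, Q. J. Math. 73 (2022) 729–757,
arXiv:2009.08969v2 [Lichtman2020], Theorem 1.1) along the CORRECTED typical sets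
`S_c = lichtmanTypicalWith c`, `c ≥ 100` (`MoebiusShiftedPrimesTypical.lean`: the first interval of
`S` is `[(log X)^{cA}, H/(log X)^{4A}]` instead of the printed `[(log X)^{33A}, …]`, because the printed
proof of Proposition 5.1 loses a factor `V²`; see the module docstring of that file).  This file
re-targets to `S_c` the three layers of the tree that sit between Theorem 2.2 and Proposition 3.4,
each being the c = 33 proof of the tree with `lichtmanTypical` replaced by `lichtmanTypicalWith c`
(the only place where the value of the exponent enters is `W = (log X)^A < P₁`, resp. `d² ≤ W < P₁`,
true for every `c > 1`):

* `Lichtman2020_minorArcEstimateWith`, `Lichtman2020_majorArcEstimateWith`,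
  `Lichtman2020_keyFourierEstimateLiouvilleWith'` — NAMED FACTS (corrected parameter): Propositions
  3.1, 3.2 and 2.3 (regime `H ≤ exp((log X)^{2/3})`) along `S_c`, `c ≥ 100`, verbatim the statements
  `Lichtman2020_minorArcEstimate`, `Lichtman2020_majorArcEstimate`,
  `Lichtman2020_keyFourierEstimateLiouville'` of `MoebiusShiftedPrimesArcs.lean` with the predicate swapped
  and the prefix `∀ c ≥ 100`.
* PROVED: `Lichtman2020_keyFourierEstimateLiouvilleWith'_of_arcs` (Prop 2.3_c ⇐ 3.1_c + 3.2_c, as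
  `Lichtman2020_keyFourierEstimateLiouville'_of_arcs`), `Lichtman2020_keyFourierEstimateWith_of_liouville'`
  (Thm 2.2_c ⇐ Prop 2.3_c, as `Lichtman2020_keyFourierEstimate_of_liouville'`, with
  `lichtmanTypicalWith_sq_mul_iff`), `Lichtman2020_majorArcEstimateWith_of_liouvilleMeanSquareWith`
  (Prop 3.2_c ⇐ Prop 3.4_c, as `Lichtman2020_majorArcEstimate_of_liouvilleMeanSquare`), and the
  composites down to Theorem 1.1 (power range):
  `lichtman2020_moebius_shifted_primes_avg_power_of_minorArcWith
    (h31 : Lichtman2020_minorArcEstimateWith) (h51 : Lichtman2020_dirichletMeanValueWith)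
    (h48 : Lichtman2020_liouvilleCharacterSifted)`
  through `Lichtman2020_liouvilleMeanSquareWith_of_dirichletMeanValueWith`
  (`MoebiusShiftedPrimesMeanSquare.lean`) and
  `lichtman2020_moebius_shifted_primes_avg_power_of_keyFourierEstimateWith`
  (`MoebiusShiftedPrimesDecompositionWith.lean`).

What remains for an unconditional Theorem 1.1 along this chain: the minor arcs along `S_c`
(`Lichtman2020_minorArcEstimateWith`; the tree's proof `Lichtman2020_minorArcEstimate_holds` is written
for `P₁ = W^{33}` and goes through for any `P₁ ≥ W^{33}`), Proposition 5.1_c (proved in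
`MoebiusShiftedPrimesDirichletMeanValue.lean` from Lemma 4.5), and the printed inputs Lemma 4.5
(`Lichtman2020_primeCharacterSum`) and Lemma 4.8 (`Lichtman2020_liouvilleCharacterSifted`).

## Sources

* J. D. Lichtman, arXiv:2009.08969v2, §2 (Thm 2.2 ⇐ Prop 2.3, p. 8), §3 (Props 3.1, 3.2, 3.4 and the
  deduction of Prop 3.2, pp. 9–11) [Lichtman2020].
-/

open Filter Asymptotics Finset MeasureTheory
open scoped FourierTransform Topology

namespace Literature.NumberTheory.Sieve

/-! ### The three statements along `S_c` (named facts, corrected parameter) -/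

/-- NAMED FACT (corrected parameter) — **Lichtman 2020, Proposition 3.1 (key minor arc estimate)
along `S_c`, `c ≥ 100`**: the statement `Lichtman2020_minorArcEstimate` of
`MoebiusShiftedPrimesArcs.lean` (Proposition 3.1, p. 9, with the two deviations documented there) with
`lichtmanTypical` replaced by `lichtmanTypicalWith c`, for every `c ≥ 100` (module docstring of
`MoebiusShiftedPrimesTypical.lean` for the reason).  The printed proof (§3.1) only uses `P ≥ P₁ ≥ W^{24}`
about the first interval, so it covers every `c ≥ 33`.
Users take `(h : Lichtman2020_minorArcEstimateWith)`. [cite: Lichtman2020, Proposition 3.1] -/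
def Lichtman2020_minorArcEstimateWith : Prop :=
  ∀ c : ℝ, 100 ≤ c → ∀ A : ℝ, 5 < A → ∀ δ : ℝ, 0 ≤ δ → ∀ H : ℕ → ℕ,
    Tendsto (fun X : ℕ => Real.log (H X) / Real.log (Real.log X)) atTop atTop →
    (∀ᶠ X : ℕ in atTop, (H X : ℝ) ≤ Real.exp (Real.log X ^ (2 / 3 : ℝ))) →
    ∃ C : ℝ, ∀ᶠ X : ℕ in atTop, ∀ d : ℕ, 1 ≤ d → (d : ℝ) ≤ Real.log X ^ A →
      ∀ g : ℕ → ℂ, g 1 = 1 → (∀ m n : ℕ, g (m * n) = g m * g n) → (∀ n : ℕ, ‖g n‖ ≤ 1) →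
      ∀ α ∈ lichtmanMinorArcs (Real.log X ^ A) ((H X : ℝ) / Real.log X ^ (4 * A)),
        ∫ x in (0 : ℝ)..X,
            ‖twistedSum g ((Icc ⌈x / d⌉₊ ⌊(x + H X) / d⌋₊).filter (lichtmanTypicalWith c X A δ (H X))) α‖
          ≤ C * ((H X : ℝ) * X / ((d : ℝ) ^ (3 / 4 : ℝ) * Real.log X ^ (A / 5)))

/-- NAMED FACT (corrected parameter) — **Lichtman 2020, Proposition 3.2 (key major arc estimate for
`λ`) along `S_c`, `c ≥ 100`**: the statement `Lichtman2020_majorArcEstimate` of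
`MoebiusShiftedPrimesArcs.lean` with `lichtmanTypical` replaced by `lichtmanTypicalWith c`, for every
`c ≥ 100`.  PROVED below from Proposition 3.4 along `S_c`
(`Lichtman2020_majorArcEstimateWith_of_liouvilleMeanSquareWith`).
Users take `(h : Lichtman2020_majorArcEstimateWith)`. [cite: Lichtman2020, Proposition 3.2] -/
def Lichtman2020_majorArcEstimateWith : Prop :=
  ∀ c : ℝ, 100 ≤ c → ∀ A : ℝ, 5 < A → ∀ δ : ℝ, 0 < δ → ∀ H : ℕ → ℕ,
    Tendsto (fun X : ℕ => Real.log (H X) / Real.log (Real.log X)) atTop atTop →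
    (∀ᶠ X : ℕ in atTop, (H X : ℝ) ≤ Real.exp (Real.log X ^ (2 / 3 : ℝ))) →
    ∃ C : ℝ, ∀ᶠ X : ℕ in atTop, ∀ d : ℕ, 1 ≤ d → (d : ℝ) ≤ Real.log X ^ A →
      ∀ α ∈ lichtmanMajorArcs (Real.log X ^ A) ((H X : ℝ) / Real.log X ^ (4 * A)),
        ∫ x in (0 : ℝ)..X,
            ‖liouvilleTwistedSum
                ((Icc ⌈x / d⌉₊ ⌊(x + H X) / d⌋₊).filter (lichtmanTypicalWith c X A δ (H X))) α‖
          ≤ C * ((H X : ℝ) * X / ((d : ℝ) * Real.log X ^ A))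

/-- NAMED FACT (corrected parameter) — **Lichtman 2020, Proposition 2.3 in the regime
`H ≤ exp((log X)^{2/3})`, along `S_c`, `c ≥ 100`**: the statement
`Lichtman2020_keyFourierEstimateLiouville'` of `MoebiusShiftedPrimesArcs.lean` with `lichtmanTypical`
replaced by `lichtmanTypicalWith c`, for every `c ≥ 100`.  PROVED below from the two arcs
(`Lichtman2020_keyFourierEstimateLiouvilleWith'_of_arcs`).
Users take `(h : Lichtman2020_keyFourierEstimateLiouvilleWith')`. [cite: Lichtman2020, Proposition 2.3] -/
def Lichtman2020_keyFourierEstimateLiouvilleWith' : Prop :=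
  ∀ c : ℝ, 100 ≤ c → ∀ A : ℝ, 5 < A → ∀ δ : ℝ, 0 < δ → ∀ H : ℕ → ℕ,
    Tendsto (fun X : ℕ => Real.log (H X) / Real.log (Real.log X)) atTop atTop →
    (∀ᶠ X : ℕ in atTop, (H X : ℝ) ≤ Real.exp (Real.log X ^ (2 / 3 : ℝ))) →
    ∃ C : ℝ, ∀ᶠ X : ℕ in atTop, ∀ d : ℕ, 1 ≤ d → (d : ℝ) ≤ Real.log X ^ A → ∀ α : ℝ,
      ∫ x in (0 : ℝ)..X,
          ‖liouvilleTwistedSum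
              ((Icc ⌈x / d⌉₊ ⌊(x + H X) / d⌋₊).filter (lichtmanTypicalWith c X A δ (H X))) α‖
        ≤ C * ((H X : ℝ) * X / ((d : ℝ) ^ (3 / 4 : ℝ) * Real.log X ^ (A / 5)))

namespace Lichtman2020

/-- If every prime `p ≤ d` is `< P₁ = (log X)^{cA}` and `< P₂` (`d ≥ 1`), then `d²m ∈ S_c ↔ m ∈ S_c`
(as `lichtmanTypical_sq_mul_iff`). [folklore] -/
theorem lichtmanTypicalWith_sq_mul_iff {c X A δ Hr : ℝ} {d : ℕ} (hd : 1 ≤ d)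
    (h1 : (d : ℝ) < Real.log X ^ (c * A))
    (h2 : (d : ℝ) < Real.exp (Real.log X ^ (2 / 3 + δ / 2))) (m : ℕ) :
    lichtmanTypicalWith c X A δ Hr (d ^ 2 * m) ↔ lichtmanTypicalWith c X A δ Hr m := by
  have hd0 : d ^ 2 ≠ 0 := pow_ne_zero 2 (by omega)
  have hp : ∀ p ∈ (d ^ 2).primeFactors, (p : ℝ) ≤ d := fun p hp => by
    rw [Nat.primeFactors_pow _ two_ne_zero] at hp
    exact_mod_cast Nat.le_of_mem_primeFactors hp
  unfold lichtmanTypicalWith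
  rw [hasPrimeFactorIn_mul_iff hd0 (fun p hp' => (hp p hp').trans_lt h1),
    hasPrimeFactorIn_mul_iff hd0 (fun p hp' => (hp p hp').trans_lt h2)]

end Lichtman2020

/-! ### Proposition 2.3_c from the arcs, Theorem 2.2_c from Proposition 2.3_c -/

open Lichtman2020 in
/-- **Proposition 2.3 (regime) from Propositions 3.1 and 3.2, along `S_c`** — the proof of
`Lichtman2020_keyFourierEstimateLiouville'_of_arcs` verbatim (periodicity in `α`, `[0,1] = 𝔐 ∪ 𝔪`,
Prop 3.1 with `g = λ` on `𝔪`, Prop 3.2 on `𝔐`). [cite: Lichtman2020, §3, p. 9] -/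
theorem Lichtman2020_keyFourierEstimateLiouvilleWith'_of_arcs (h31 : Lichtman2020_minorArcEstimateWith)
    (h32 : Lichtman2020_majorArcEstimateWith) : Lichtman2020_keyFourierEstimateLiouvilleWith' := by
  intro c hc A hA δ hδ H hH hHexp
  have hA0 : 0 < A := by linarith
  obtain ⟨C₁, hC₁⟩ := h31 c hc A hA δ hδ.le H hH hHexp
  obtain ⟨C₂, hC₂⟩ := h32 c hc A hA δ hδ H hH hHexp
  refine ⟨max (max C₁ C₂) 0, ?_⟩
  have hlog1 : ∀ᶠ X : ℕ in atTop, 1 ≤ Real.log X :=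
    (Real.tendsto_log_atTop.comp tendsto_natCast_atTop_atTop).eventually_ge_atTop 1
  filter_upwards [hC₁, hC₂, hlog1] with X h1 h2 hL1 d hd hdW α
  set C : ℝ := max (max C₁ C₂) 0 with hC
  have hC0 : 0 ≤ C := le_max_right _ _
  have hCC₁ : C₁ ≤ C := (le_max_left _ _).trans (le_max_left _ _)
  have hCC₂ : C₂ ≤ C := (le_max_right _ _).trans (le_max_left _ _)
  have hd1 : (1 : ℝ) ≤ d := by exact_mod_cast hd
  have hd0 : (0 : ℝ) < d := by linarith
  have hL0 : 0 < Real.log X := by linarith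
  have hden₁ : 0 < (d : ℝ) ^ (3 / 4 : ℝ) * Real.log X ^ (A / 5) :=
    mul_pos (Real.rpow_pos_of_pos hd0 _) (Real.rpow_pos_of_pos hL0 _)
  have hden₂ : 0 < (d : ℝ) * Real.log X ^ A := mul_pos hd0 (Real.rpow_pos_of_pos hL0 _)
  have hnum : 0 ≤ (H X : ℝ) * X := by positivity
  have hkey : (d : ℝ) ^ (3 / 4 : ℝ) * Real.log X ^ (A / 5) ≤ (d : ℝ) * Real.log X ^ A := by
    apply mul_le_mul _ _ (Real.rpow_nonneg hL0.le _) hd0.le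
    · calc (d : ℝ) ^ (3 / 4 : ℝ) ≤ (d : ℝ) ^ (1 : ℝ) :=
            Real.rpow_le_rpow_of_exponent_le hd1 (by norm_num)
        _ = d := Real.rpow_one _
    · exact Real.rpow_le_rpow_of_exponent_le hL1 (by linarith)
  -- reduce to `α' = fract α ∈ [0, 1]`
  have hper : ∫ x in (0 : ℝ)..X, ‖liouvilleTwistedSum
      ((Icc ⌈x / d⌉₊ ⌊(x + H X) / d⌋₊).filter (lichtmanTypicalWith c X A δ (H X))) α‖ =
      ∫ x in (0 : ℝ)..X, ‖liouvilleTwistedSum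
      ((Icc ⌈x / d⌉₊ ⌊(x + H X) / d⌋₊).filter (lichtmanTypicalWith c X A δ (H X))) (Int.fract α)‖ := by
    simp_rw [liouvilleTwistedSum_fract]
  rw [hper]
  have hmem : Int.fract α ∈ Set.Icc (0 : ℝ) 1 := ⟨Int.fract_nonneg α, (Int.fract_lt_one α).le⟩
  rcases mem_majorArcs_or_minorArcs (W := Real.log X ^ A)
      (Q₁ := (H X : ℝ) / Real.log X ^ (4 * A)) hmem with hM | hm
  · -- major arcs: Proposition 3.2
    have hb := h2 d hd hdW (Int.fract α) hM
    refine hb.trans ?_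
    calc C₂ * ((H X : ℝ) * X / ((d : ℝ) * Real.log X ^ A))
        ≤ C * ((H X : ℝ) * X / ((d : ℝ) * Real.log X ^ A)) :=
          mul_le_mul_of_nonneg_right hCC₂ (div_nonneg hnum hden₂.le)
      _ ≤ C * ((H X : ℝ) * X / ((d : ℝ) ^ (3 / 4 : ℝ) * Real.log X ^ (A / 5))) :=
          mul_le_mul_of_nonneg_left (div_le_div_of_nonneg_left hnum hden₁ hkey) hC0
  · -- minor arcs: Proposition 3.1 with `g = λ`
    have hg1 : (fun n : ℕ => ((ArithmeticFunction.liouville n : ℤ) : ℂ)) 1 = 1 := by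
      simp [ArithmeticFunction.liouville_apply_one]
    have hgmul : ∀ m n : ℕ, (fun n : ℕ => ((ArithmeticFunction.liouville n : ℤ) : ℂ)) (m * n) =
        (fun n : ℕ => ((ArithmeticFunction.liouville n : ℤ) : ℂ)) m *
          (fun n : ℕ => ((ArithmeticFunction.liouville n : ℤ) : ℂ)) n := by
      intro m n
      simp only [ArithmeticFunction.liouville_apply_mul, Int.cast_mul]
    have hgle : ∀ n : ℕ, ‖(fun n : ℕ => ((ArithmeticFunction.liouville n : ℤ) : ℂ)) n‖ ≤ 1 := by
      intro n
      simp only [Complex.norm_intCast]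
      exact_mod_cast abs_liouville_le_one n
    have hb := h1 d hd hdW _ hg1 hgmul hgle (Int.fract α) hm
    simp_rw [← liouvilleTwistedSum_eq_twistedSum] at hb
    exact hb.trans (mul_le_mul_of_nonneg_right hCC₁ (div_nonneg hnum hden₁.le))

open Lichtman2020 in
/-- **Theorem 2.2 from Proposition 2.3 (regime), along `S_c`** — the proof of
`Lichtman2020_keyFourierEstimate_of_liouville'` verbatim (`μ = λ * h`, `keyFourier_fixed_bound`), the
invariance of `S_c` under small squares being `lichtmanTypicalWith_sq_mul_iff` (`d² ≤ W < (log X)^{cA}`).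
[cite: Lichtman2020, Theorem 2.2 and Proposition 2.3] -/
theorem Lichtman2020_keyFourierEstimateWith_of_liouville'
    (h23 : Lichtman2020_keyFourierEstimateLiouvilleWith') : Lichtman2020_keyFourierEstimateWith := by
  intro c hc A hA δ hδ H hH hHexp
  have hA0 : 0 < A := by linarith
  have hone := eventually_one_le_H hH
  obtain ⟨C, hC⟩ := h23 c hc A hA δ hδ H hH hHexp
  refine ⟨3 * max C 0 + 4, ?_⟩
  have hW4 : ∀ᶠ X : ℕ in atTop, 4 ≤ Real.log X ^ A :=
    ((tendsto_rpow_atTop hA0).comp tendsto_log_natCast).eventually_ge_atTop 4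
  filter_upwards [hC, hHexp, hone, hW4, tendsto_log_natCast.eventually_gt_atTop 1,
    eventually_sqrtW_lt_P2 A δ hδ, eventually_gt_atTop 0] with X hCX hHX h1 hW4X hL1 hP2 hX0 α
  have hX0' : (0 : ℝ) < X := by exact_mod_cast hX0
  have hL0 : 0 < Real.log X := by linarith
  set W : ℝ := Real.log X ^ A with hW
  have hW0 : 0 < W := by rw [hW]; exact Real.rpow_pos_of_pos hL0 _
  have hW15 : W ^ (1 / 5 : ℝ) = Real.log X ^ (A / 5) := by
    rw [hW, ← Real.rpow_mul hL0.le]; ring_nf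
  have hHleX : H X ≤ X := by
    have h2 : Real.log X ^ (2 / 3 : ℝ) ≤ Real.log X := by
      calc Real.log X ^ (2 / 3 : ℝ) ≤ Real.log X ^ (1 : ℝ) :=
            Real.rpow_le_rpow_of_exponent_le hL1.le (by norm_num)
        _ = Real.log X := Real.rpow_one _
    have h3 : (H X : ℝ) ≤ X := by
      calc (H X : ℝ) ≤ Real.exp (Real.log X ^ (2 / 3 : ℝ)) := hHX
        _ ≤ Real.exp (Real.log X) := Real.exp_le_exp.mpr h2
        _ = X := Real.exp_log hX0'
    exact_mod_cast h3
  rw [integral_window_eq_sum (fun s => ‖moebiusTwistedSum (s.filter (lichtmanTypicalWith c X A δ (H X))) α‖)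
    X (H X) h1]
  set M : ℕ := ⌊Real.sqrt W⌋₊ with hM
  have hMle : (M : ℝ) ≤ Real.sqrt W := Nat.floor_le (Real.sqrt_nonneg _)
  have hsqrtW : Real.sqrt W = Real.log X ^ (A / 2) := by
    rw [Real.sqrt_eq_rpow, hW, ← Real.rpow_mul hL0.le]; ring_nf
  have hS : ∀ d : ℕ, 1 ≤ d → d ≤ M → ∀ m : ℕ,
      lichtmanTypicalWith c X A δ (H X) (d ^ 2 * m) ↔ lichtmanTypicalWith c X A δ (H X) m := by
    intro d hd hdM m
    have hdW : (d : ℝ) ≤ Real.log X ^ (A / 2) := by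
      rw [← hsqrtW]; exact le_trans (by exact_mod_cast hdM) hMle
    refine lichtmanTypicalWith_sq_mul_iff hd (lt_of_le_of_lt hdW ?_) (lt_of_le_of_lt hdW hP2) m
    exact Real.rpow_lt_rpow_of_exponent_lt hL1 (by nlinarith)
  have hP23 : ∀ e : ℕ, 1 ≤ e → (e : ℝ) ≤ W → ∀ β : ℝ,
      ∑ k ∈ Icc 1 X, ‖liouvilleTwistedSum ((windowDiv e (H X) k).filter
          (lichtmanTypicalWith c X A δ (H X))) β‖ ≤
        max C 0 * ((H X : ℝ) * X / ((e : ℝ) ^ (3 / 4 : ℝ) * W ^ (1 / 5 : ℝ))) := by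
    intro e he heW β
    have h := hCX e he heW β
    rw [integral_window_div_eq_sum (fun s => ‖liouvilleTwistedSum (s.filter
      (lichtmanTypicalWith c X A δ (H X))) β‖) X (H X) e he] at h
    rw [hW15]
    refine h.trans (mul_le_mul_of_nonneg_right (le_max_left _ _) ?_)
    have : 0 < (e : ℝ) ^ (3 / 4 : ℝ) := Real.rpow_pos_of_pos (by exact_mod_cast he) _
    positivity
  have hmain := keyFourier_fixed_bound (lichtmanTypicalWith c X A δ (H X)) α h1 hHleX hW4X hM le_rfl
    (le_max_right C 0) hP23 hS
  rw [hW15] at hmain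
  exact hmain

/-! ### Proposition 3.2_c from Proposition 3.4_c -/

open Lichtman2020 ArithmeticFunction in
/-- **Proposition 3.2 from Proposition 3.4, along `S_c`** — the proof of
`Lichtman2020_majorArcEstimate_of_liouvilleMeanSquare` (`MoebiusShiftedPrimesMajorArcs.lean`) verbatim;
`S_c(cm) ↔ S_c(m)` for `c ∣ q ≤ W` as `W = (log X)^A < (log X)^{cA}`. [cite: Lichtman2020, Proposition 3.2] -/
theorem Lichtman2020_majorArcEstimateWith_of_liouvilleMeanSquareWith
    (h34 : Lichtman2020_liouvilleMeanSquareWith) : Lichtman2020_majorArcEstimateWith := by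
  intro cc hcc A hA δ hδ H hH hHexp
  have hA0 : 0 < A := by linarith
  obtain ⟨C, hC⟩ := h34 cc hcc A hA δ hδ H hH hHexp
  obtain ⟨C', hC'⟩ : ∃ C' : ℝ, C' = max C 0 := ⟨_, rfl⟩
  have hC'0 : 0 ≤ C' := by rw [hC']; exact le_max_right _ _
  have hCC' : C ≤ C' := by rw [hC']; exact le_max_left _ _
  refine ⟨2 * (6 + 12 * Real.sqrt C') + 2 * Real.pi * (6 + 12 * Real.sqrt C') + 8 * Real.pi, ?_⟩
  -- eventual inequalities
  have hW2 : ∀ᶠ X : ℕ in atTop, 2 ≤ Real.log X ^ A :=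
    ((tendsto_rpow_atTop hA0).comp tendsto_log_natCast).eventually_ge_atTop 2
  have hH6 : ∀ᶠ X : ℕ in atTop, Real.log X ^ (6 * A) ≤ H X := eventually_rpow_log_le_H hH (6 * A)
  have hX6 : ∀ᶠ X : ℕ in atTop, Real.log X ^ (6 * A) ≤ X := eventually_rpow_log_le_natCast (6 * A)
  have hP2 : ∀ᶠ X : ℕ in atTop, Real.log X ^ A < Real.exp (Real.log X ^ (2 / 3 + δ / 2)) := by
    filter_upwards [eventually_sqrtW_lt_P2 (2 * A) δ hδ] with X hX
    rwa [show 2 * A / 2 = A by ring] at hX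
  have hlog1 : ∀ᶠ X : ℕ in atTop, 1 < Real.log X := tendsto_log_natCast.eventually_gt_atTop 1
  filter_upwards [hC, hW2, hH6, hX6, hP2, hlog1, eventually_ge_atTop 1] with X hCX hW2X hH6X hX6X
    hP2X hlog1X hX1 d hd hdW α hα
  have hL0 : 0 < Real.log X := by linarith
  -- powers of `W = (log X)^A`
  have hpow : ∀ n : ℕ, Real.log X ^ ((n : ℝ) * A) = (Real.log X ^ A) ^ n := fun n => by
    rw [mul_comm, Real.rpow_mul hL0.le, Real.rpow_natCast]
  have h4 : Real.log X ^ (4 * A) = (Real.log X ^ A) ^ 4 := by exact_mod_cast hpow 4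
  have h5 : Real.log X ^ (5 * A) = (Real.log X ^ A) ^ 5 := by exact_mod_cast hpow 5
  have h6 : Real.log X ^ (6 * A) = (Real.log X ^ A) ^ 6 := by exact_mod_cast hpow 6
  have h10 : Real.log X ^ (10 * A) = (Real.log X ^ A) ^ 10 := by exact_mod_cast hpow 10
  rw [h6] at hH6X hX6X
  set W : ℝ := Real.log X ^ A with hWdef
  have hW0 : 0 < W := by linarith
  have hHX0 : (0 : ℝ) < H X := lt_of_lt_of_le (by positivity) hH6X
  -- the major arc datum `α = a/q + θ`
  simp only [lichtmanMajorArcs, lichtmanMajorArc, Set.mem_iUnion, Set.mem_setOf_eq] at hα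
  obtain ⟨q, ⟨hq1, hqW⟩, a, -, hθ'⟩ := hα
  have hq0 : (0 : ℝ) < q := by exact_mod_cast hq1
  obtain ⟨θ, hθdef⟩ : ∃ θ : ℝ, θ = α - a / q := ⟨_, rfl⟩
  have hαθ : (a : ℝ) / q + θ = α := by rw [hθdef]; ring
  have hθ : |θ| ≤ W ^ 4 / (q * H X) := by
    rw [h4] at hθ'
    rw [hθdef]
    calc |α - a / q| ≤ 1 / (q * (H X / W ^ 4)) := hθ'
      _ = W ^ 4 / (q * H X) := by field_simp
  -- the integral is a finite sum over `k ≤ X`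
  rw [integral_window_div_eq_sum
    (fun s => ‖liouvilleTwistedSum (s.filter (lichtmanTypicalWith cc X A δ (H X))) α‖) X (H X) d hd]
  -- `S(cm) ↔ S(m)` for `c ∣ q`
  have hS : ∀ c ∈ q.divisors, ∀ m,
      lichtmanTypicalWith cc X A δ (H X) (c * m) ↔ lichtmanTypicalWith cc X A δ (H X) m := by
    intro c hc m
    have hc0 : c ≠ 0 := (Nat.pos_of_mem_divisors hc).ne'
    have hcW : (c : ℝ) ≤ W := le_trans (by exact_mod_cast Nat.divisor_le hc) hqW
    have hp : ∀ p ∈ c.primeFactors, (p : ℝ) ≤ W := fun p hp =>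
      le_trans (by exact_mod_cast Nat.le_of_mem_primeFactors hp) hcW
    have hWP1 : W < Real.log X ^ (cc * A) :=
      Real.rpow_lt_rpow_of_exponent_lt hlog1X (by nlinarith)
    unfold lichtmanTypicalWith
    rw [hasPrimeFactorIn_mul_iff hc0 (fun p hp' => (hp p hp').trans_lt hWP1),
      hasPrimeFactorIn_mul_iff hc0 (fun p hp' => (hp p hp').trans_lt hP2X)]
  -- Proposition 3.4 for the moduli `q/c`, discretised
  have h34d : ∀ c ∈ q.divisors, ∀ χ : DirichletCharacter ℂ (q / c), ∀ h : ℕ,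
      (H X : ℝ) / W ^ 5 ≤ h → h ≤ H X → ∀ Y : ℕ, (X : ℝ) / W ^ 6 ≤ Y → Y ≤ X →
        ∑ k ∈ Ioc Y (2 * Y), ‖∑ m ∈ (Icc k (k + h - 1)).filter (lichtmanTypicalWith cc X A δ (H X)),
            χ (m : ZMod (q / c)) * ((liouville m : ℤ) : ℂ)‖ ^ 2 ≤
          C' * ((h : ℝ) ^ 2 * Y / W ^ 10) := by
    intro c hc χ h hh1 hh2 Y hY1 hY2
    have hc0 : 0 < c := Nat.pos_of_mem_divisors hc
    have hcq : c ∣ q := Nat.dvd_of_mem_divisors hc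
    have hq'1 : 1 ≤ q / c := Nat.div_pos (Nat.le_of_dvd hq1 hcq) hc0
    have hq'W : ((q / c : ℕ) : ℝ) ≤ W := le_trans (by exact_mod_cast Nat.div_le_self q c) hqW
    have hh1' : (H X : ℝ) / Real.log X ^ (5 * A) ≤ h := by rwa [h5]
    have hY1' : (X : ℝ) / Real.log X ^ (6 * A) ≤ (Y : ℝ) := by rwa [h6]
    have hY2' : ((Y : ℕ) : ℝ) ≤ X := by exact_mod_cast hY2
    have hint := hCX (q / c) hq'1 hq'W χ h hh1' hh2 Y hY1' hY2'
    rw [h10] at hint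
    have hh0 : 1 ≤ h := by
      have e1 : W ≤ (H X : ℝ) / W ^ 5 := by
        rw [le_div_iff₀ (by positivity)]
        calc W * W ^ 5 = W ^ 6 := by ring
          _ ≤ (H X : ℝ) := hH6X
      have : (1 : ℝ) ≤ h := by linarith
      exact_mod_cast this
    have hdisc := integral_window_eq_sum_Ioc (fun s => ‖∑ m ∈ s.filter (lichtmanTypicalWith cc X A δ (H X)),
        ((liouville m : ℤ) : ℂ) * χ (m : ZMod (q / c))‖ ^ 2) Y (2 * Y) h (by omega) hh0
    have hcast : ((2 * Y : ℕ) : ℝ) = 2 * (Y : ℝ) := by push_cast; ring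
    rw [hcast] at hdisc
    rw [hdisc] at hint
    have hcomm : ∀ s : Finset ℕ, ∑ m ∈ s, χ (m : ZMod (q / c)) * ((liouville m : ℤ) : ℂ) =
        ∑ m ∈ s, ((liouville m : ℤ) : ℂ) * χ (m : ZMod (q / c)) :=
      fun s => Finset.sum_congr rfl fun m _ => mul_comm _ _
    simp only [hcomm]
    exact hint.trans (mul_le_mul_of_nonneg_right hCC' (by positivity))
  -- the bound at the fixed scale `X`
  have hcore := majorArc_fixed_bound (X := X) (H := H X) (d := d) (q := q) (a := a) (θ := θ)
    (W := W) (C := C') (lichtmanTypicalWith cc X A δ (H X)) hX1 hd hdW hq1 hqW hW2X hH6X hX6X hθ hC'0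
    hS h34d
  rw [hαθ] at hcore
  simp only [liouvilleTwistedSum]
  exact hcore

/-! ### Composites -/

open Lichtman2020 in
/-- **Theorem 2.2_c from Proposition 3.1_c and Proposition 3.4_c.** [cite: Lichtman2020, Theorem 2.2] -/
theorem Lichtman2020_keyFourierEstimateWith_of_minorArc_of_liouvilleMeanSquareWith
    (h31 : Lichtman2020_minorArcEstimateWith) (h34 : Lichtman2020_liouvilleMeanSquareWith) :
    Lichtman2020_keyFourierEstimateWith :=
  Lichtman2020_keyFourierEstimateWith_of_liouville'
    (Lichtman2020_keyFourierEstimateLiouvilleWith'_of_arcs h31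
      (Lichtman2020_majorArcEstimateWith_of_liouvilleMeanSquareWith h34))

open Lichtman2020 in
/-- **Lichtman's Theorem 1.1 (power range) from Proposition 3.1_c, Proposition 5.1_c and Lemma 4.8**,
through Proposition 3.4_c (`Lichtman2020_liouvilleMeanSquareWith_of_dirichletMeanValueWith`),
Proposition 3.2_c, Proposition 2.3_c, Theorem 2.2_c (this file) and the power-range deduction
`lichtman2020_moebius_shifted_primes_avg_power_of_keyFourierEstimateWith`. [cite: Lichtman2020, Theorem 1.1] -/
theorem lichtman2020_moebius_shifted_primes_avg_power_of_minorArcWith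
    (h31 : Lichtman2020_minorArcEstimateWith) (h51 : Lichtman2020_dirichletMeanValueWith)
    (h48 : Lichtman2020_liouvilleCharacterSifted) : lichtman2020_moebius_shifted_primes_avg_power :=
  lichtman2020_moebius_shifted_primes_avg_power_of_keyFourierEstimateWith
    (Lichtman2020_keyFourierEstimateWith_of_minorArc_of_liouvilleMeanSquareWith h31
      (Lichtman2020_liouvilleMeanSquareWith_of_dirichletMeanValueWith h51 h48))

end Literature.NumberTheory.Sieve
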